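import Summits.CriticalPhenomena.SAWScalingLimit.Theorems.SAWRenewalTightnessSubseqIdentificationRestrictionAssembly
import Summits.CriticalPhenomena.SAWScalingLimit.Theses.SAWEdgeOfPositiveType
import HarnessLib

/-!
# Line `confinement-pin` for crux `SubseqIdentification` (stmt-CriticalPhenomena-0783) — strategist s2

**Idea.** Keep the landed restriction composition of line `boundary-area-law`
(`SubseqIdentification_of_restriction`: dock S1 + reference flat window + carved half-ball + lattice
restriction identity + SLE restriction rigidity BELOW 8/3), but replace its one-sided QUANTITATIVE lattice
companion S4⁺ (`LatticeAreaUpperBound`, exponent-2 rarity of boundary visits, whose only job is `κ ≤ 8/3`)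
by the QUALITATIVE, already-filed, tightness-programme input `ConfinementPositivity` (stmt-CriticalPhenomena-17587,
a split child of `EventualTight` stmt-1372): carving a small boundary half-disc far from the marked points costs at
most a constant factor of SAW mass.  The price is paid on the SLE side, where the objects are explicit: the phases
`κ > 8/3` are excluded by three SLE statements —
* `stub_sleRestrictionRigidityAbove` (8/3 < κ ≤ 4: SLE_κ violates the one-hull restriction identity; the
  λ < 0 side of [LSW03, Thm. 6.5 / §8], NEW in tree — the hardest SLE stub),
* `stub_sleTouchesCarvedArc` (4 < κ < 8: SLE_κ of the carved domain touches the carved semicircle with positive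
  probability — boundary hitting, in tree for ℍ as the same-side swallowing law),
* `stub_sleSpaceFillingNearWindow` (κ ≥ 8: space-filling SLE leaves no room at a flat window — in tree as
  `ae_isSpaceFilling_sleTrace_of_hasSLETrace_apply` + window transport),
while `κ < 8/3` is the LANDED `stub_sleRestrictionRigidityBelow` and `κ = 8/3` is the conclusion.
Confinement positivity enters exactly once: it makes the limit room probability `ν₀ {dist(x₀,·) ≥ r}` positive,
which is what turns the restriction identity into a contradiction for `4 < κ < 8` (identity at the null level
set `{dist = r}`) and for `κ ≥ 8` (room probability zero).

Deciding theorem: `SubseqIdentification_of : S1 → R↑ → Rmid → R8 → ConfinementPositivity → EventualTight →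
SubseqIdentification` (items stmt-17587 and stmt-1372 BY NAME; every other input is a theorem of the tree).
-/

noncomputable section

open MeasureTheory Filter Topology Set
open scoped NNReal ENNReal BoundedContinuousFunction

open Literature.Probability.RandomPlanarGeometry Literature.Probability.LatticeModels
open Summit.CriticalPhenomena.SAWScalingLimit.Theses.SAWParafermion (SubseqIdentification)
open Summit.CriticalPhenomena.SAWScalingLimit.Theses.SAWRenewalTightness (EventualTight ConfinementPositivity)
open Summit.CriticalPhenomena.SAWScalingLimit.Theorems.SubseqIdentification
open Summit.CriticalPhenomena.SAWScalingLimit.Theorems.SubseqIdentification.BoundaryAreaLaw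

namespace Summit.CriticalPhenomena.SAWScalingLimit.Cruxes.SubseqIdentification.ConfinementPin

/-! ## Registered stubs -/

/-- **S1 (dock; shared verbatim with lines `boundary-area-law` / `restriction-character`).** Along every mesh
sequence there is ONE `κ > 0` such that every subsequential limit of the critical SAW bridge law in every Dobrushin
domain along that sequence is an SLE_κ law of the domain (discrete domain Markov property + conformal invariance of
the limits ⇒ Schramm's principle).  OPEN (the conformal-invariance half is the summit's heart).
[cite: LawlerSchrammWerner2004SAW, §2; Schramm2000] -/
theorem stub_identificationUpToKappa :
    ∀ (s : ℕ → ℝ), Tendsto s atTop (𝓝[>] (0 : ℝ)) →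
      ∃ κ : ℝ≥0, 0 < κ ∧
        ∀ (D : DobrushinDomain) (a b : ℝ → Site 2), SAW.IsEndpointApprox D a b →
          ∀ (μ : Measure (CurveClass ℂ)), IsProbabilityMeasure μ →
            (∀ f : CurveClass ℂ →ᵇ ℝ,
              Tendsto (fun n => ∫ γ, f γ.curve ∂(SAW.law D.carrier (s n) (a (s n)) (b (s n))))
                atTop (𝓝 (∫ x, f x ∂μ))) →
            IsSLELaw κ D μ := by
  sorry

/-- **R↑ (SLE restriction rigidity ABOVE 8/3; the hardest SLE stub, new in tree).** For `8/3 < κ ≤ 4`, an SLE_κ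
law `μ` of a Dobrushin domain `D` with a flat window at `x₀` and an SLE_κ law `μ'` of the carved domain
`D' = D ∖ B̄(x₀,r)` (same marked points) never satisfy the one-hull restriction identity
`μ'(T) · μ{dist(x₀,·) ≥ r} = μ(T ∩ {dist(x₀,·) ≥ r})`.  Reason: for `κ ≤ 4` the law of SLE_κ in `D'` is absolutely
continuous w.r.t. SLE_κ in `D` on `{γ ⊂ D'}` with density `∝ exp(−λ_κ · m_D(γ, B̄(x₀,r)))` (Brownian-loop /
bubble mass), and `λ_κ = (8 − 3κ)(6 − κ)/(2κ) ≠ 0` for `κ ≠ 8/3`, so the conditional law is NOT SLE_κ of `D'`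
[LSW03, Thm. 6.5, §8.1; Lawler 2005, Prop. 6.?/§9].  Below 8/3 (λ > 0, Poisson bubbles) this is the landed
`stub_sleRestrictionRigidityBelow`; above 8/3 (λ < 0) the tilted-law identity needs the supermartingale /
loop-soup form.  Why it might fail: only the formalization debt (integrability of the exponential tilt for λ < 0);
the statement is printed mathematics.  The two extra hypotheses (the level set `{dist = r}` is `μ`-null and the room
`{dist ≥ r}` has positive `μ`-mass) are supplied by the composition and only weaken the stub. -/
theorem stub_sleRestrictionRigidityAbove :
    ∀ (κ : ℝ≥0), 8 / 3 < κ → κ ≤ 4 →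
      ∀ (D D' : DobrushinDomain) (μ μ' : Measure (CurveClass ℂ)) (x₀ : ℂ) (ρ₀ r : ℝ),
        0 < r → r < ρ₀ →
        D.carrier ∩ Metric.ball x₀ ρ₀ = {z : ℂ | x₀.im < z.im} ∩ Metric.ball x₀ ρ₀ →
        ρ₀ ≤ dist x₀ (D.pt 0) → ρ₀ ≤ dist x₀ (D.pt 1) →
        D'.carrier = D.carrier \ Metric.closedBall x₀ r → D'.pt 0 = D.pt 0 → D'.pt 1 = D.pt 1 →
        IsSLELaw κ D μ → IsSLELaw κ D' μ' →
        μ {c | Metric.infDist x₀ c.range = r} = 0 →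
        μ {c | r ≤ Metric.infDist x₀ c.range} ≠ 0 →
        ¬ ∀ T : Set (CurveClass ℂ), MeasurableSet T →
            μ' T * μ {c | r ≤ Metric.infDist x₀ c.range} =
              μ (T ∩ {c | r ≤ Metric.infDist x₀ c.range}) := by
  sorry

/-- **Rmid (SLE boundary touching, 4 < κ < 8).** An SLE_κ law of the carved domain `D' = D ∖ B̄(x₀,r)` (flat window of
`D` at `x₀`, radius `r` below the window radius and the distances to the marked points) gives positive mass to the
curves TOUCHING the carved semicircle, i.e. to the level set `{dist(x₀, trace) = r}` (curves of `D'` satisfy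
`dist ≥ r`).  In ℍ this is the same-side swallowing law `P[T_u ≠ T_{u'}] = (h(∞) − h(u'/u))/(h(∞) − h(1)) > 0`
for `4 < κ < 8` [Lawler 2005, Prop. 6.8 / 6.33; AlbertsKozdron2008, Thm. 1.1], transported by the uniformizing map
of `D'`, which sends the semicircle onto a real interval avoiding `0, ∞` (tree: `SLEBoundaryHitting*`,
`SLEBoundaryProximity`, `IsCompactifiedImage`).  Why it might fail: only if `IsSLELaw` did not carry the boundary
extension of the uniformizing map (it does: compactified image). -/
theorem stub_sleTouchesCarvedArc :
    ∀ (κ : ℝ≥0), 4 < κ → κ < 8 →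
      ∀ (D D' : DobrushinDomain) (μ' : Measure (CurveClass ℂ)) (x₀ : ℂ) (ρ₀ r : ℝ),
        0 < r → r < ρ₀ →
        D.carrier ∩ Metric.ball x₀ ρ₀ = {z : ℂ | x₀.im < z.im} ∩ Metric.ball x₀ ρ₀ →
        ρ₀ ≤ dist x₀ (D.pt 0) → ρ₀ ≤ dist x₀ (D.pt 1) →
        D'.carrier = D.carrier \ Metric.closedBall x₀ r → D'.pt 0 = D.pt 0 → D'.pt 1 = D.pt 1 →
        IsSLELaw κ D' μ' →
        μ' {c | Metric.infDist x₀ c.range = r} ≠ 0 := by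
  sorry

/-- **R8 (space-filling phase, κ ≥ 8).** An SLE_κ law, `κ ≥ 8`, of a Dobrushin domain with a flat window at `x₀`
leaves NO room at the window: `μ {dist(x₀, trace) ≥ r} = 0` for every `r > 0` (the trace is a.s. space-filling,
`ae_isSpaceFilling_sleTrace_of_hasSLETrace_apply` with `IsSLELaw.hasSLETrace`, and the window transport
`stub_windowTransport` / `infDist_image_lt_of_window` of the `KappaLeOfUpper` file compares ℍ-balls at the preimage
of `x₀` with `D`-balls at `x₀`).  [RohdeSchramm2005, Thm. 7.9; Lawler 2005, Prop. 6.?]  Why it might fail: it does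
not (provable from tree facts; size M, mostly transport bookkeeping). -/
theorem stub_sleSpaceFillingNearWindow :
    ∀ (κ : ℝ≥0), 8 ≤ κ →
      ∀ (D : DobrushinDomain) (μ : Measure (CurveClass ℂ)) (x₀ : ℂ) (ρ₀ : ℝ),
        IsSLELaw κ D μ → 0 < ρ₀ →
        D.carrier ∩ Metric.ball x₀ ρ₀ = {z : ℂ | x₀.im < z.im} ∩ Metric.ball x₀ ρ₀ →
        x₀ ≠ D.pt 0 → x₀ ≠ D.pt 1 →
        ∀ r : ℝ, 0 < r → μ {c | r ≤ Metric.infDist x₀ c.range} = 0 := by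
  sorry

/-! ## Proved glue: a closed event keeps its eventual lattice lower bound in the limit (portmanteau) -/

/-- Portmanteau for a closed set along a SAW sequence: if the test integrals of `γ ↦ γ.curve` under the SAW laws
converge to those of a probability measure `μ`, and eventually the SAW probability of `{γ | γ.curve ∈ F}` is at
least `c`, then `c ≤ μ F` for closed `F`. [folklore] -/
theorem le_measure_closed_of_eventually_le (Ω : Set ℂ) (a b : ℝ → Site 2) (t : ℕ → ℝ)
    (μ : Measure (CurveClass ℂ)) [hμ : IsProbabilityMeasure μ] {F : Set (CurveClass ℂ)}
    (hF : IsClosed F) {c : ℝ≥0∞}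
    (hlim : ∀ f : CurveClass ℂ →ᵇ ℝ,
      Tendsto (fun n => ∫ γ, f γ.curve ∂(SAW.law Ω (t n) (a (t n)) (b (t n)))) atTop
        (𝓝 (∫ x, f x ∂μ)))
    (hev : ∀ᶠ n in atTop, c ≤ SAW.law Ω (t n) (a (t n)) (b (t n)) {γ | γ.curve ∈ F}) :
    c ≤ μ F := by
  obtain ⟨N₀, hN₀⟩ := eventually_atTop.1
    ((Negative.eventually_isProbabilityMeasure_of_tendsto (hlim 1)).and hev)
  have hP : ∀ k, IsProbabilityMeasure (SAW.law Ω (t (k + N₀)) (a (t (k + N₀))) (b (t (k + N₀)))) :=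
    fun k => (hN₀ _ (N₀.le_add_left k)).1
  have hconv := tendsto_map_curve_of_forall_integral_tendsto (t := fun k => t (k + N₀)) hP
    (fun f => (hlim f).comp (tendsto_add_atTop_nat N₀))
  have hls := ProbabilityMeasure.limsup_measure_closed_le_of_tendsto hconv hF
  refine le_trans ?_ hls
  refine le_limsup_of_frequently_le (Eventually.of_forall fun k => ?_).frequently
  have hk := (hN₀ _ (N₀.le_add_left k)).2
  change c ≤ ((SAW.law Ω (t (k + N₀)) (a (t (k + N₀))) (b (t (k + N₀)))).map fun γ => γ.curve) F
  rw [Measure.map_apply (SAW.DomainSAW.measurable_of_top _) hF.measurableSet]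
  exact hk

/-! ## The deciding theorem -/

/-- **THE COMPOSITION (hypotheses form): THE DOCK, THREE SLE RIGIDITY/HITTING FACTS ABOVE 8/3, CONFINEMENT POSITIVITY
AND TIGHTNESS GIVE THE CRUX BODY.** `S1 → R↑ → Rmid → R8 → ConfinementPositivity → EventualTight → (the unfolded
statement of SubseqIdentification)`; the reference window (S2),
the subsequential limits (T′ ⇒ S3), the carved sub-domain (RS2a), the lattice nesting (RS2b), the restriction
identity (RS3) and the rigidity below 8/3 (RS5) are theorems of the tree. -/
theorem restrictionPin_of_hyps
    (h₁ : ∀ (s : ℕ → ℝ), Tendsto s atTop (𝓝[>] (0 : ℝ)) →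
      ∃ κ : ℝ≥0, 0 < κ ∧
        ∀ (D : DobrushinDomain) (a b : ℝ → Site 2), SAW.IsEndpointApprox D a b →
          ∀ (μ : Measure (CurveClass ℂ)), IsProbabilityMeasure μ →
            (∀ f : CurveClass ℂ →ᵇ ℝ,
              Tendsto (fun n => ∫ γ, f γ.curve ∂(SAW.law D.carrier (s n) (a (s n)) (b (s n))))
                atTop (𝓝 (∫ x, f x ∂μ))) →
            IsSLELaw κ D μ)
    (hup : ∀ (κ : ℝ≥0), 8 / 3 < κ → κ ≤ 4 →
      ∀ (D D' : DobrushinDomain) (μ μ' : Measure (CurveClass ℂ)) (x₀ : ℂ) (ρ₀ r : ℝ),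
        0 < r → r < ρ₀ →
        D.carrier ∩ Metric.ball x₀ ρ₀ = {z : ℂ | x₀.im < z.im} ∩ Metric.ball x₀ ρ₀ →
        ρ₀ ≤ dist x₀ (D.pt 0) → ρ₀ ≤ dist x₀ (D.pt 1) →
        D'.carrier = D.carrier \ Metric.closedBall x₀ r → D'.pt 0 = D.pt 0 → D'.pt 1 = D.pt 1 →
        IsSLELaw κ D μ → IsSLELaw κ D' μ' →
        μ {c | Metric.infDist x₀ c.range = r} = 0 →
        μ {c | r ≤ Metric.infDist x₀ c.range} ≠ 0 →
        ¬ ∀ T : Set (CurveClass ℂ), MeasurableSet T →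
            μ' T * μ {c | r ≤ Metric.infDist x₀ c.range} =
              μ (T ∩ {c | r ≤ Metric.infDist x₀ c.range}))
    (hmid : ∀ (κ : ℝ≥0), 4 < κ → κ < 8 →
      ∀ (D D' : DobrushinDomain) (μ' : Measure (CurveClass ℂ)) (x₀ : ℂ) (ρ₀ r : ℝ),
        0 < r → r < ρ₀ →
        D.carrier ∩ Metric.ball x₀ ρ₀ = {z : ℂ | x₀.im < z.im} ∩ Metric.ball x₀ ρ₀ →
        ρ₀ ≤ dist x₀ (D.pt 0) → ρ₀ ≤ dist x₀ (D.pt 1) →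
        D'.carrier = D.carrier \ Metric.closedBall x₀ r → D'.pt 0 = D.pt 0 → D'.pt 1 = D.pt 1 →
        IsSLELaw κ D' μ' →
        μ' {c | Metric.infDist x₀ c.range = r} ≠ 0)
    (h8 : ∀ (κ : ℝ≥0), 8 ≤ κ →
      ∀ (D : DobrushinDomain) (μ : Measure (CurveClass ℂ)) (x₀ : ℂ) (ρ₀ : ℝ),
        IsSLELaw κ D μ → 0 < ρ₀ →
        D.carrier ∩ Metric.ball x₀ ρ₀ = {z : ℂ | x₀.im < z.im} ∩ Metric.ball x₀ ρ₀ →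
        x₀ ≠ D.pt 0 → x₀ ≠ D.pt 1 →
        ∀ r : ℝ, 0 < r → μ {c | r ≤ Metric.infDist x₀ c.range} = 0)
    (hCP : ConfinementPositivity) (hT : EventualTight) :
    ∀ (D : DobrushinDomain) (a b : ℝ → Site 2), SAW.IsEndpointApprox D a b →
      ∀ (s : ℕ → ℝ) (μ : Measure (CurveClass ℂ)), Tendsto s atTop (𝓝[>] (0 : ℝ)) →
        IsProbabilityMeasure μ →
        (∀ f : CurveClass ℂ →ᵇ ℝ,
          Tendsto (fun n => ∫ γ, f γ.curve ∂(SAW.law D.carrier (s n) (a (s n)) (b (s n)))) atTop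
            (𝓝 (∫ x, f x ∂μ))) →
        IsSLELaw ((8 : ℝ≥0) / 3) D μ := by
  intro D a b hab s μ hs hμ hlim
  -- S2 (tree): the reference window; shrink its radius below the distances to the marked points
  obtain ⟨D₀, a₀, b₀, x₀, ρ₀, hab₀, hρ₀, hx0, hx1, hwin⟩ := stub_referenceWindow
  set ρ₁ : ℝ := min ρ₀ (min (dist x₀ (D₀.pt 0)) (dist x₀ (D₀.pt 1))) with hρ₁def
  have hρ₁ : 0 < ρ₁ := lt_min hρ₀ (lt_min (dist_pos.2 hx0) (dist_pos.2 hx1))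
  have hρ₁ρ₀ : ρ₁ ≤ ρ₀ := min_le_left _ _
  have hρ₁a : ρ₁ ≤ dist x₀ (D₀.pt 0) := (min_le_right _ _).trans (min_le_left _ _)
  have hρ₁b : ρ₁ ≤ dist x₀ (D₀.pt 1) := (min_le_right _ _).trans (min_le_right _ _)
  have hwin₁ : D₀.carrier ∩ Metric.ball x₀ ρ₁ = {z : ℂ | x₀.im < z.im} ∩ Metric.ball x₀ ρ₁ :=
    window_mono_c4 hwin hρ₁ρ₀
  -- T′ (item, by name) ⇒ S3: a subsequential limit `ν₀` in the reference domain along `s ∘ φ₀`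
  have h₃ := subseqLimitsExist_of_eventualTight hT
  obtain ⟨φ₀, hφ₀, ν₀, hν₀, hlim₀⟩ := h₃ D₀ a₀ b₀ hab₀ s hs
  have hs₀ : Tendsto (s ∘ φ₀) atTop (𝓝[>] (0 : ℝ)) := hs.comp hφ₀.tendsto_atTop
  -- a good radius
  haveI := hν₀
  obtain ⟨r, hr0, hr4, hatom⟩ := exists_radius_level_null ν₀ x₀ hρ₁
  have hrρ₁ : r < ρ₁ := by linarith
  -- RS2a/RS2b (tree): the carved sub-domain, its endpoint approximation and lattice nesting
  obtain ⟨D₁, hcar, hpt0, hpt1⟩ := stub_halfBallSubdomain D₀ x₀ ρ₁ r hr0 hrρ₁ hwin₁ hρ₁a hρ₁b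
  obtain ⟨hab₁, hnest⟩ :=
    stub_halfBallNesting D₀ D₁ a₀ b₀ x₀ ρ₁ r hab₀ hr0 hr4 hwin₁ hρ₁a hρ₁b hcar hpt0 hpt1
  -- S3 again: a subsequential limit `ν₁` in the carved domain along `s ∘ φ₀ ∘ φ₁`
  obtain ⟨φ₁, hφ₁, ν₁, hν₁, hlim₁⟩ := h₃ D₁ a₀ b₀ hab₁ (s ∘ φ₀) hs₀
  have hs₁ : Tendsto (s ∘ φ₀ ∘ φ₁) atTop (𝓝[>] (0 : ℝ)) := hs₀.comp hφ₁.tendsto_atTop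
  have hlim₀' : ∀ f : CurveClass ℂ →ᵇ ℝ,
      Tendsto (fun n => ∫ γ, f γ.curve
          ∂(SAW.law D₀.carrier ((s ∘ φ₀ ∘ φ₁) n) (a₀ ((s ∘ φ₀ ∘ φ₁) n)) (b₀ ((s ∘ φ₀ ∘ φ₁) n))))
        atTop (𝓝 (∫ x, f x ∂ν₀)) :=
    fun f => (hlim₀ f).comp hφ₁.tendsto_atTop
  have hlim₁' : ∀ f : CurveClass ℂ →ᵇ ℝ,
      Tendsto (fun n => ∫ γ, f γ.curve
          ∂(SAW.law D₁.carrier ((s ∘ φ₀ ∘ φ₁) n) (a₀ ((s ∘ φ₀ ∘ φ₁) n)) (b₀ ((s ∘ φ₀ ∘ φ₁) n))))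
        atTop (𝓝 (∫ x, f x ∂ν₁)) := hlim₁
  -- S1: one `κ` along the final subsequence for `D`, `D₀` and `D₁`
  obtain ⟨κ, hκ, hdock⟩ := h₁ (s ∘ φ₀ ∘ φ₁) hs₁
  have hD : IsSLELaw κ D μ :=
    hdock D a b hab μ hμ fun f => ((hlim f).comp hφ₀.tendsto_atTop).comp hφ₁.tendsto_atTop
  have hD₀ : IsSLELaw κ D₀ ν₀ := hdock D₀ a₀ b₀ hab₀ ν₀ hν₀ hlim₀'
  have hD₁ : IsSLELaw κ D₁ ν₁ := hdock D₁ a₀ b₀ hab₁ ν₁ hν₁ hlim₁'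
  -- CP (item, by name) at the carved pair `D₁ ⊆ D₀`, sockets of radius `ρ₁ - r` around the marked points
  have hsub : D₁.carrier ⊆ D₀.carrier := by
    rw [hcar]
    exact fun _ hz => hz.1
  have hsock : D₀.carrier ∩ (Metric.ball (D₀.pt 0) (ρ₁ - r) ∪ Metric.ball (D₀.pt 1) (ρ₁ - r)) ⊆
      D₁.carrier := by
    rw [hcar]
    rintro z ⟨hz, hzb⟩
    refine ⟨hz, fun hzr => ?_⟩
    rw [Metric.mem_closedBall] at hzr
    rcases hzb with hzb | hzb
    · rw [Metric.mem_ball] at hzb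
      have := dist_triangle x₀ z (D₀.pt 0)
      rw [dist_comm x₀ z] at this
      linarith
    · rw [Metric.mem_ball] at hzb
      have := dist_triangle x₀ z (D₀.pt 1)
      rw [dist_comm x₀ z] at this
      linarith
  obtain ⟨c, δc, hc, hδc, hconf⟩ :=
    hCP D₀ D₁ a₀ b₀ (ρ₁ - r) (by linarith) hsub hpt0 hpt1 hsock hab₁
  -- the limit room probability is positive: portmanteau on the closed event `{dist ≥ r}`
  have hN : IsClosed {c : CurveClass ℂ | r ≤ Metric.infDist x₀ c.range} :=
    isClosed_le continuous_const (lipschitzWith_infDist_range_c4 x₀).continuous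
  have hmem : ∀ᶠ n in atTop, (s ∘ φ₀ ∘ φ₁) n ∈ Set.Ioc (0 : ℝ) δc := by
    have h1 : ∀ᶠ n in atTop, (s ∘ φ₀ ∘ φ₁) n ∈ Set.Ioi (0 : ℝ) :=
      hs₁.eventually self_mem_nhdsWithin
    have h2 : ∀ᶠ n in atTop, (s ∘ φ₀ ∘ φ₁) n < δc :=
      (tendsto_nhds_of_tendsto_nhdsWithin hs₁).eventually_lt_const hδc
    filter_upwards [h1, h2] with n h1 h2 using ⟨h1, h2.le⟩
  have hev : ∀ᶠ n in atTop, ENNReal.ofReal c ≤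
      SAW.law D₀.carrier ((s ∘ φ₀ ∘ φ₁) n) (a₀ ((s ∘ φ₀ ∘ φ₁) n)) (b₀ ((s ∘ φ₀ ∘ φ₁) n))
        {γ | γ.curve ∈ {c : CurveClass ℂ | r ≤ Metric.infDist x₀ c.range}} := by
    filter_upwards [hmem, hs₁.eventually hnest] with n hn hne
    refine (hconf _ hn).trans (measure_mono ?_)
    intro γ hγ
    exact hne.2.2 γ hγ
  have hroom : ENNReal.ofReal c ≤ ν₀ {c : CurveClass ℂ | r ≤ Metric.infDist x₀ c.range} :=
    le_measure_closed_of_eventually_le D₀.carrier a₀ b₀ (s ∘ φ₀ ∘ φ₁) ν₀ hN hlim₀' hev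
  have hpos : ν₀ {c : CurveClass ℂ | r ≤ Metric.infDist x₀ c.range} ≠ 0 :=
    (lt_of_lt_of_le (ENNReal.ofReal_pos.2 hc) hroom).ne'
  -- RS3 (tree): the restriction identity between `ν₁` and `ν₀` at radius `r`
  have hident := stub_restrictionPassage D₀.carrier D₁.carrier a₀ b₀ (s ∘ φ₀ ∘ φ₁) ν₀ ν₁ x₀ r hs₁ hν₀
    hν₁ hlim₀' hlim₁' (hs₁.eventually hnest) hatom
  -- the phases of κ
  rcases lt_trichotomy κ (8 / 3) with hlt | heq | hgt
  · -- κ < 8/3: RS5 (tree)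
    exact absurd hident (stub_sleRestrictionRigidityBelow κ hκ hlt D₀ D₁ ν₀ ν₁ x₀ ρ₁ r hr0 hrρ₁ hwin₁
      hρ₁a hρ₁b hcar hpt0 hpt1 hD₀ hD₁)
  · rw [heq] at hD
    exact hD
  · rcases le_or_gt κ 4 with h4 | h4
    · -- 8/3 < κ ≤ 4: R↑
      exact absurd hident (hup κ hgt h4 D₀ D₁ ν₀ ν₁ x₀ ρ₁ r hr0 hrρ₁ hwin₁ hρ₁a hρ₁b hcar hpt0 hpt1
        hD₀ hD₁ hatom hpos)
    · rcases lt_or_ge κ 8 with hκ8 | hκ8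
      · -- 4 < κ < 8: Rmid at the null level set
        have hT := hmid κ h4 hκ8 D₀ D₁ ν₁ x₀ ρ₁ r hr0 hrρ₁ hwin₁ hρ₁a hρ₁b hcar hpt0 hpt1 hD₁
        refine absurd ?_ hT
        have hmeasT : MeasurableSet {c : CurveClass ℂ | Metric.infDist x₀ c.range = r} :=
          (isClosed_eq (lipschitzWith_infDist_range_c4 x₀).continuous continuous_const).measurableSet
        have hid := hident _ hmeasT
        have hzero : ν₀ ({c : CurveClass ℂ | Metric.infDist x₀ c.range = r} ∩
            {c : CurveClass ℂ | r ≤ Metric.infDist x₀ c.range}) = 0 :=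
          measure_mono_null inter_subset_left hatom
        rw [hzero, mul_eq_zero] at hid
        exact hid.resolve_right hpos
      · -- κ ≥ 8: R8, no room at the window
        exact absurd (h8 κ hκ8 D₀ ν₀ x₀ ρ₀ hD₀ hρ₀ hwin hx0 hx1 r hr0) hpos

/-- **THE SKELETON THEOREM (registered).** The crux from the two named ITEMS `ConfinementPositivity`
(stmt-CriticalPhenomena-17587) and `EventualTight` (stmt-CriticalPhenomena-1372), every other input being a registered
stub of this line (`stub_*`, by name) or a theorem of the tree.  Sorries live only inside the four stubs. -/
theorem SubseqIdentification_of (hCP : ConfinementPositivity) (hT : EventualTight) :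
    SubseqIdentification :=
  restrictionPin_of_hyps stub_identificationUpToKappa stub_sleRestrictionRigidityAbove
    stub_sleTouchesCarvedArc stub_sleSpaceFillingNearWindow hCP hT

/-- The same skeleton theorem for the decl of route `SAWEdgeOfPositiveType` (identical text, defeq). -/
theorem SubseqIdentification_of' (hCP : ConfinementPositivity) (hT : EventualTight) :
    Summit.CriticalPhenomena.SAWScalingLimit.Theses.SAWEdgeOfPositiveType.SubseqIdentification :=
  SubseqIdentification_of hCP hT

/-- … and for route `SAWRenewalTightness`, the home route of both named items (identical text, defeq). -/
theorem SubseqIdentification_of'' (hCP : ConfinementPositivity) (hT : EventualTight) :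
    Summit.CriticalPhenomena.SAWScalingLimit.Theses.SAWRenewalTightness.SubseqIdentification :=
  SubseqIdentification_of hCP hT

end Summit.CriticalPhenomena.SAWScalingLimit.Cruxes.SubseqIdentification.ConfinementPin

end
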